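import Summits.ResolutionOfSingularities.ResolutionOfSingularities.Theorems.EquisingularLiftEquisingularLiftNatCarrierDeltaFlat
import Literature.AlgebraicGeometry.Resolution.BlowupChartSNCLocal
import Literature.RingTheory.MvPolynomial.ZariskiClosureIdealQuotients
import HarnessLib

/-!
# [OURS · L1 W4.5(b) · EL♮] T-STFLAT-GEN, ring level: the uniformizer stays a nonzerodivisor modulo the SATURATION
# `⋃ₙ (L·R[I/a] : aⁿ)` of ANY ideal `L` modulo which it is a nonzerodivisor — the chart algebra of the strict transform of an
# `O`-flat closed subscheme under ANY blow-up (crux `EquisingularLiftNat` stmt-ResolutionOfSingularities-20038 / child stmt-20148; every rung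
# of the `sections` line: TC⁺ section steps (K7b), DIR₀ direction steps, TC⁺⁺ cluster steps)

NOT a statement of any manuscript. Helper file of the chain res-L1-w45b (cell `res-hironaka`, LADDER-RESOLUTION rung L, slot W4.5(b));
OURS; AI-written, weaker than expert review; `--supports stmt-ResolutionOfSingularities-20038 --as helper` by res-L1-w45b-stub-2 (own object
T-STFLAT-GEN, the structure-free form of K7b). No `sorry`; standard axioms. It closes nothing by itself.

WHAT. `R` any commutative ring, `I ⊆ R` an ideal, `a ∈ R`, `B = R[I/a] ⊆ R[1/a]` the affine blow-up algebra (Literature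
`blowupAlgebra`), `t = a/1 ∈ B` the exceptional equation, `L ⊆ R` any ideal and `w ∈ R` with `w·y ∈ L ⇒ y ∈ L` (in use: `L` the stalk of
the ideal of an `O`-flat closed subscheme, `w` the uniformizer). The strict transform of `V(L)` on the chart is cut out by the SATURATION
`(L·B : t^∞) = ⋃ₙ (L·B : tⁿ)`, and:

* `exists_pow_mul_eq_algebraMap` — every `y ∈ R[I/a]` has `tᵏ·y = r/1` for some `k`, `r`;
* `exists_pow_mul_mem_map_of_mul_mem_map` — if `tⁿ·w·y ∈ L·B` then `tᴺ·y ∈ L·B` for some `N` (clear denominators in `R[1/a]`, use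
  `w`-regularity of `L` in `R`);
* **`mem_iSup_colon_of_mul_mem`** — `w·y ∈ (L·B : t^∞) ⇒ y ∈ (L·B : t^∞)`: the uniformizer is a nonzerodivisor modulo the strict
  transform ideal; `…_localization` — the same in every localisation `S` of `B` for the saturation `⋃ₙ (L·S : tⁿ)` computed in `S`.

Scheme level (companion …NatStrictTransformFlat): `Flat ((strictTransformIdeal τ J C).subschemeι ≫ τ ≫ r)` from `Flat (C.subschemeι ≫ r)` for
ANY blow-up `τ` of `X` along `J` over a DVR — Hartshorne III 9.7 (flat over a DVR = torsion-free) + this file on the stalks over `supp J`.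

References: R. Hartshorne, *Algebraic Geometry* (1977), III Prop. 9.7; The Stacks Project, Tags 052Q, 07Z3, 080C, 080E (strict transform =
blow-up of the restricted ideal); U. Görtz, T. Wedhorn, *Algebraic Geometry I* (2020), (13.19). Tree inputs: Literature AffineBlowupAlgebra,
BlowupChartSNCLocal (`mem_colon_span_singleton_pow_iff`), res-type-100 …NatCarrierDeltaFlat (`mem_map_of_mul_mem_localization`).
-/

set_option linter.dupNamespace false -- mandated namespace `Summit.<Summit>.<Problem>` of this single-conjunct summit

noncomputable section

namespace Summit.ResolutionOfSingularities.ResolutionOfSingularities.Cruxes.EquisingularLiftNat.Sections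

open IsLocalization Literature.AlgebraicGeometry.Resolution

universe u

section Chart

variable {R : Type u} [CommRing R] (I : Ideal R) (a : R)

/-- Every element of the affine blow-up algebra `R[I/a] ⊆ R[1/a]` becomes an element of `R` after multiplication by a power of the
exceptional equation `t = a/1`. [cite: StacksProject, Tag 052Q] -/
theorem exists_pow_mul_eq_algebraMap (y : blowupAlgebra I a) :
    ∃ (k : ℕ) (r : R), algebraMap R (blowupAlgebra I a) a ^ k * y = algebraMap R (blowupAlgebra I a) r := by
  obtain ⟨⟨r, ⟨_, k, rfl⟩⟩, h⟩ := IsLocalization.surj (Submonoid.powers a) (y : Localization.Away a)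
  refine ⟨k, r, Subtype.ext ?_⟩
  change algebraMap R (Localization.Away a) a ^ k * (y : Localization.Away a) = algebraMap R (Localization.Away a) r
  rw [mul_comm, ← map_pow]
  exact h

/-- **Clearing denominators**: if `tⁿ·(w·y) ∈ L·R[I/a]` and `w` is a nonzerodivisor modulo `L` in `R`, then `tᴺ·y ∈ L·R[I/a]` for some
`N`. [folklore] -/
theorem exists_pow_mul_mem_map_of_mul_mem_map (L : Ideal R) (w : R) (hw : ∀ z : R, w * z ∈ L → z ∈ L)
    (y : blowupAlgebra I a) (n : ℕ)
    (h : algebraMap R (blowupAlgebra I a) a ^ n * (algebraMap R (blowupAlgebra I a) w * y) ∈ L.map (algebraMap R (blowupAlgebra I a))) :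
    ∃ N : ℕ, algebraMap R (blowupAlgebra I a) a ^ N * y ∈ L.map (algebraMap R (blowupAlgebra I a)) := by
  obtain ⟨k, r, hkr⟩ := exists_pow_mul_eq_algebraMap I a y
  -- push the membership to `R[1/a]`
  have hmapval : (L.map (algebraMap R (blowupAlgebra I a))).map (blowupAlgebra I a).val.toRingHom ≤
      L.map (algebraMap R (Localization.Away a)) := by
    rw [Ideal.map_map]
    exact le_of_eq (congrArg (Ideal.map · L) (RingHom.ext fun x => rfl))
  have h' : (algebraMap R (Localization.Away a) a ^ n * (algebraMap R (Localization.Away a) w * (y : Localization.Away a))) ∈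
      L.map (algebraMap R (Localization.Away a)) := by
    have := hmapval (Ideal.mem_map_of_mem (blowupAlgebra I a).val.toRingHom h)
    simpa using this
  obtain ⟨⟨⟨ℓ, hℓ⟩, ⟨_, m, rfl⟩⟩, hℓeq⟩ := (IsLocalization.mem_map_algebraMap_iff (Submonoid.powers a) (Localization.Away a)).mp h'
  simp only at hℓeq
  -- `w · (a^{n+m} r) = a^{m+k} ℓ` up to `a`-power torsion
  have hkr' : algebraMap R (Localization.Away a) a ^ k * (y : Localization.Away a) = algebraMap R (Localization.Away a) r := by
    have := congrArg (Subtype.val : blowupAlgebra I a → Localization.Away a) hkr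
    simpa only [Subalgebra.coe_mul, Subalgebra.coe_pow, Subalgebra.coe_algebraMap] using this
  have heq : algebraMap R (Localization.Away a) (w * a ^ (n + m) * r) = algebraMap R (Localization.Away a) (a ^ k * ℓ) := by
    rw [map_mul, map_mul, map_mul, ← hℓeq, map_pow, map_pow, map_pow, ← hkr']
    ring
  obtain ⟨⟨_, e, rfl⟩, he⟩ := (IsLocalization.eq_iff_exists (Submonoid.powers a) (Localization.Away a)).mp heq
  simp only at he
  -- `w · (a^{e+n+m} r) ∈ L`, hence `a^{e+n+m} r ∈ L`
  have hmem : a ^ e * a ^ (n + m) * r ∈ L := by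
    refine hw _ ?_
    have : w * (a ^ e * a ^ (n + m) * r) = a ^ e * (a ^ k * ℓ) := by rw [← he]; ring
    rw [this, ← mul_assoc]
    exact L.mul_mem_left _ hℓ
  refine ⟨e + (n + m) + k, ?_⟩
  have hcalc : algebraMap R (blowupAlgebra I a) a ^ (e + (n + m) + k) * y =
      algebraMap R (blowupAlgebra I a) (a ^ e * a ^ (n + m) * r) := by
    rw [pow_add, mul_assoc, hkr, map_mul, map_mul, map_pow, map_pow, ← pow_add]
  rw [hcalc]
  exact Ideal.mem_map_of_mem _ hmem

/-- **The uniformizer is a nonzerodivisor modulo the strict transform ideal `(L·R[I/a] : t^∞)`.** If `w·z ∈ L ⇒ z ∈ L` in `R`, then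
`w·y ∈ ⋃ₙ (L·B : tⁿ) ⇒ y ∈ ⋃ₙ (L·B : tⁿ)` on `B = R[I/a]`. [cite: Hartshorne1977, III Prop. 9.7 p. 257]
[OURS · L1 W4.5b] T-STFLAT-GEN; NOT a statement of the manuscript. -/
theorem mem_iSup_colon_of_mul_mem (L : Ideal R) (w : R) (hw : ∀ z : R, w * z ∈ L → z ∈ L) (y : blowupAlgebra I a)
    (h : algebraMap R (blowupAlgebra I a) w * y ∈ ⨆ n : ℕ, Submodule.colon (L.map (algebraMap R (blowupAlgebra I a)))
      ((Ideal.span {algebraMap R (blowupAlgebra I a) a} ^ n : Ideal (blowupAlgebra I a)) : Set (blowupAlgebra I a))) :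
    y ∈ ⨆ n : ℕ, Submodule.colon (L.map (algebraMap R (blowupAlgebra I a)))
      ((Ideal.span {algebraMap R (blowupAlgebra I a) a} ^ n : Ideal (blowupAlgebra I a)) : Set (blowupAlgebra I a)) := by
  rw [Literature.RingTheory.MvPolynomial.ZariskiClosureIdealQuotients.mem_iSup_colon_pow_iff] at h ⊢
  obtain ⟨n, hn⟩ := h
  have hn' := hn _ (Ideal.pow_mem_pow (Ideal.mem_span_singleton_self _) n)
  rw [mul_comm] at hn'
  obtain ⟨N, hN⟩ := exists_pow_mul_mem_map_of_mul_mem_map I a L w hw y n hn'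
  refine ⟨N, fun g hg => ?_⟩
  rw [Ideal.span_singleton_pow] at hg
  obtain ⟨g', rfl⟩ := Ideal.mem_span_singleton'.mp hg
  rw [show y * (g' * algebraMap R (blowupAlgebra I a) a ^ N) = g' * (algebraMap R (blowupAlgebra I a) a ^ N * y) by ring]
  exact Ideal.mul_mem_left _ _ hN

/-- **The same in every localisation `S` of the chart** `B = R[I/a]` (the local rings of the blow-up at the points of `D₊(a)`), for the
saturation `⋃ₙ ((L·B)·S : tⁿ)` computed IN `S` (this is the stalk of the strict transform ideal, Literature `stalkIdeal_strictTransformIdeal`):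
`w·z ∈ ⋃ₙ ((L·B)S : tⁿ) ⇒ z ∈ ⋃ₙ ((L·B)S : tⁿ)`. [cite: Hartshorne1977, III Prop. 9.7 p. 257] [OURS · L1 W4.5b] T-STFLAT-GEN. -/
theorem mem_iSup_colon_of_mul_mem_localization (L : Ideal R) (w : R) (hw : ∀ z : R, w * z ∈ L → z ∈ L)
    (M : Submonoid (blowupAlgebra I a)) (S : Type*) [CommRing S] [Algebra (blowupAlgebra I a) S] [IsLocalization M S] (z : S)
    (h : algebraMap (blowupAlgebra I a) S (algebraMap R (blowupAlgebra I a) w) * z ∈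
      ⨆ n : ℕ, Submodule.colon ((L.map (algebraMap R (blowupAlgebra I a))).map (algebraMap (blowupAlgebra I a) S))
        ((Ideal.span {algebraMap (blowupAlgebra I a) S (algebraMap R (blowupAlgebra I a) a)} ^ n : Ideal S) : Set S)) :
    z ∈ ⨆ n : ℕ, Submodule.colon ((L.map (algebraMap R (blowupAlgebra I a))).map (algebraMap (blowupAlgebra I a) S))
        ((Ideal.span {algebraMap (blowupAlgebra I a) S (algebraMap R (blowupAlgebra I a) a)} ^ n : Ideal S) : Set S) := by
  rw [Literature.RingTheory.MvPolynomial.ZariskiClosureIdealQuotients.mem_iSup_colon_pow_iff] at h ⊢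
  obtain ⟨n, hn⟩ := h
  have hn' := hn _ (Ideal.pow_mem_pow (Ideal.mem_span_singleton_self _) n)
  -- write `z = y/u` and clear the denominator
  obtain ⟨⟨y, u⟩, hz⟩ := IsLocalization.mk'_surjective M z
  simp only at hz
  subst hz
  have h1 : IsLocalization.mk' S (algebraMap R (blowupAlgebra I a) a ^ n * algebraMap R (blowupAlgebra I a) w * y) u ∈
      (L.map (algebraMap R (blowupAlgebra I a))).map (algebraMap (blowupAlgebra I a) S) := by
    have heq : IsLocalization.mk' S (algebraMap R (blowupAlgebra I a) a ^ n * algebraMap R (blowupAlgebra I a) w * y) u =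
        algebraMap (blowupAlgebra I a) S (algebraMap R (blowupAlgebra I a) w) * IsLocalization.mk' S y u *
          algebraMap (blowupAlgebra I a) S (algebraMap R (blowupAlgebra I a) a) ^ n := by
      rw [← IsLocalization.mul_mk'_eq_mk'_of_mul, map_mul, map_pow]; ring
    rw [heq]
    exact hn'
  obtain ⟨s, hs, hsy⟩ := (IsLocalization.mk'_mem_map_algebraMap_iff M S _ _ u).mp h1
  -- `tⁿ · (w · (s y)) ∈ L·B`, so `tᴺ · (s y) ∈ L·B` for some `N`
  have h2 : algebraMap R (blowupAlgebra I a) a ^ n * (algebraMap R (blowupAlgebra I a) w * (s * y)) ∈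
      L.map (algebraMap R (blowupAlgebra I a)) := by
    have : algebraMap R (blowupAlgebra I a) a ^ n * (algebraMap R (blowupAlgebra I a) w * (s * y)) =
        s * (algebraMap R (blowupAlgebra I a) a ^ n * algebraMap R (blowupAlgebra I a) w * y) := by ring
    rw [this]
    exact hsy
  obtain ⟨N, hN⟩ := exists_pow_mul_mem_map_of_mul_mem_map I a L w hw (s * y) n h2
  refine ⟨N, fun g hg => ?_⟩
  rw [Ideal.span_singleton_pow] at hg
  obtain ⟨g', rfl⟩ := Ideal.mem_span_singleton'.mp hg
  -- `(y/u) · tᴺ = (tᴺ y)/u ∈ (L·B)S` since `s · (tᴺ y) ∈ L·B`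
  have h3 : IsLocalization.mk' S y u * algebraMap (blowupAlgebra I a) S (algebraMap R (blowupAlgebra I a) a) ^ N ∈
      (L.map (algebraMap R (blowupAlgebra I a))).map (algebraMap (blowupAlgebra I a) S) := by
    rw [← map_pow, mul_comm, IsLocalization.mul_mk'_eq_mk'_of_mul, IsLocalization.mk'_mem_map_algebraMap_iff M S]
    refine ⟨s, hs, ?_⟩
    have : s * (algebraMap R (blowupAlgebra I a) a ^ N * y) = algebraMap R (blowupAlgebra I a) a ^ N * (s * y) := by ring
    rw [this]
    exact hN
  rw [show IsLocalization.mk' S y u * (g' * algebraMap (blowupAlgebra I a) S (algebraMap R (blowupAlgebra I a) a) ^ N) =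
      g' * (IsLocalization.mk' S y u * algebraMap (blowupAlgebra I a) S (algebraMap R (blowupAlgebra I a) a) ^ N) by ring]
  exact Ideal.mul_mem_left _ _ h3

end Chart

end Summit.ResolutionOfSingularities.ResolutionOfSingularities.Cruxes.EquisingularLiftNat.Sections

end
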